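import Summits.QuantumFields.YangMills.Theorems.AlphaInputsT3ACv3OneBlockLiftShapes
import HarnessLib

/-!
# `AlphaInputsT3ACv3OneBlockLiftBounds` — (r1-ob) THE ONE-BLOCK LIFT, PART 3: SUPPORT (one block) and the SUP BOUND `|obLift A (b)| ≤ 1056·‖A‖_{loc}/L^k` — lane `pub-balaban3d` ∕
# cell `ym3-torus`, seat alpha-2 (g6); kernel of record for the regional Newton route (★★OWNER g25 03:01:17Z, LEAD ★w1-19936 g2 03:02:18Z)

WHY.  The regional Newton shell (★w4-19936 (A)∕(B)∕(C)) needs of its right inverse `R`, besides exactness (`…v3OneBlockLift`), (iii) a sup bound `‖R u‖ ≤ ρ_R‖u‖` with `ρ_R = O(L^{−k})`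
read LOCALLY, and the support statement that lets the twisted version frame every kernel on ONE block.  THIS FILE (1D shape bounds in the sibling `…v3OneBlockLiftShapes`): §2 the centre offsets `ctr = L^k/2`, `0 ≤ χ ≤ 1`, `|dχ| ≤ 3/L^k`, and ★ SUPPORT: `obKernel y α b = 0` unless
`coarsen k b.src = y` (the gauge part lives on bonds with BOTH ends in `B^k(y)`); §3 ★ `|e⁰| ≤ 64/L^k`, `|Ψ_k(e⁰)(y)| ≤ 96`, ★ `|obKernel| ≤ 352/L^k`, ★★ `abs_obLift_le_local`
(`≤ 1056·max_α |A(coarsen b₋, α)|/L^k`), `abs_obLift_le`, `obLift_congr_local`.  Curls in the sibling `…v3OneBlockLiftCurl`.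
HONEST FRAMING.  Kernel estimates of explicit lattice functions (constants not optimised: numerics give `≈ 16/L^k`); count-neutral helper toward the (FL)∕KIN row `hLift` of R3
2′∕2′χ (`stub_laneRecordsV3`, items 19935∕19936 — NOT proved here); registry untouched; nothing about d = 4, the continuum, or a mass gap; YM₃ on T³ is rung R3, not Clay.

References: T. Bałaban, Commun. Math. Phys. 109 (1987) 249–301 [Balaban1987RG1] ((0.3) p.252, (0.4)+(0.11) p.253); CMP 102 (1985) 277–309 [Balaban1985Variational] ((8) p.279).
-/

set_option autoImplicit false

noncomputable section

namespace Summit.QuantumFields.YangMills.Theorems.AbelianEML.OneBlock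

open scoped BigOperators
open Literature.MathematicalPhysics.QuantumFieldTheory.Balaban1983to89
open Literature.MathematicalPhysics.QuantumFieldTheory.Balaban1983to89.T3ContinuumYM3Torus
open Literature.MathematicalPhysics.QuantumFieldTheory.Balaban1983to89.B10Eq38TorusDomains (toFine)
open Summit.QuantumFields.YangMills.Theorems.AbelianEML.Shapes1D
open Summit.QuantumFields.YangMills.Theorems.AbelianEML.Tensor (rho form3 N0 nc sizes le_standing coarsen_eq_iff rho_shift_mod)
open Summit.QuantumFields.YangMills.Theorems.LinearLiftGauge (dgrad psiIter)
open Summit.QuantumFields.YangMills.Theorems.LinearLiftSpread (val_toFine)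
open Summit.QuantumFields.YangMills.Theorems.LinearAvgSup (abs_psiIter_le')
open Summit.QuantumFields.Balaban3D.Carriers (coarsen)

/-! ## §2 The centre offsets, the bump `χ_y`, and the support of the kernel -/

section Support

variable {F : T3Family} {K k : ℕ}

/-- `L^k` is odd: `L^k = 2m + 1`, and `m ≥ 1` once `L^k ≥ 3`. [cite: Balaban1987RG1, (0.1) p.251] -/
theorem pow_odd (hn3 : 3 ≤ F.L ^ k) : ∃ m : ℕ, F.L ^ k = 2 * m + 1 ∧ 1 ≤ m := by
  obtain ⟨m, hm⟩ := (F.hL.1.pow : Odd (F.L ^ k))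
  exact ⟨m, hm, by omega⟩

/-- **THE CENTRE OFFSETS ARE `L^k / 2`** (the centred inclusion `toFine`, `L` odd). [cite: Balaban1987RG1, (0.1) p.251] -/
theorem ctr_eq (hk : k ≤ K) (y : Site (F.P K) k) (i : Fin 3) : ctr F K k y i = F.L ^ k / 2 := by
  obtain ⟨h1, h2, h3⟩ := sizes (F := F) hk
  unfold ctr rho
  rw [val_toFine k (le_standing hk) y i, N0_sub_eq hk y i]
  have hy : (y i).val < nc F K k := ZMod.val_lt (y i)
  have hYle : F.L ^ k * (y i).val ≤ F.L ^ k * nc F K k := Nat.mul_le_mul_left _ hy.le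
  have hsub : F.L ^ k * (nc F K k - (y i).val) = F.L ^ k * nc F K k - F.L ^ k * (y i).val := mul_tsub _ _ _
  have e : (y i).val * F.L ^ k + F.L ^ k / 2 + F.L ^ k * (nc F K k - (y i).val) = F.L ^ k / 2 + N0 F K := by
    rw [hsub, h1, mul_comm ((y i).val) (F.L ^ k)]
    omega
  show ((y i).val * F.L ^ k + F.L ^ k / 2 + F.L ^ k * (nc F K k - (y i).val)) % N0 F K = F.L ^ k / 2
  rw [e, Nat.add_mod_right, Nat.mod_eq_of_lt]
  calc F.L ^ k / 2 < F.L ^ k := Nat.div_lt_self (by omega) one_lt_two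
    _ ≤ N0 F K := by rw [h1]; exact Nat.le_mul_of_pos_right _ (by omega)

/-- **`0 ≤ χ_y ≤ 1`.** [cite: Balaban1987RG1, (0.3) p.252] -/
theorem chiB_mem (hk : k ≤ K) (hn3 : 3 ≤ F.L ^ k) (y : Site (F.P K) k) (z : Site (F.P K) 0) : 0 ≤ chiB F K k y z ∧ chiB F K k y z ≤ 1 := by
  obtain ⟨h1, h2, h3⟩ := sizes (F := F) hk
  obtain ⟨m, hm, hm1⟩ := pow_odd (F := F) hn3
  have hc : ∀ i, ctr F K k y i = m := fun i => by rw [ctr_eq hk y i, hm]; omega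
  unfold chiB
  simp_rw [hc]
  refine ⟨Finset.prod_nonneg fun i _ => (bumpS_facts hm hm1 h1 h2 _).1, ?_⟩
  exact Finset.prod_le_one (fun i _ => (bumpS_facts hm hm1 h1 h2 _).1) fun i _ => (bumpS_facts hm hm1 h1 h2 _).2.1

/-- **`|dχ_y(b)| ≤ 3/L^k`** — along a bond only the offset in its direction moves, by one cyclic step. [cite: Balaban1987RG1, (0.3) p.252] -/
theorem abs_dgrad_chiB_le (hk : k ≤ K) (hn3 : 3 ≤ F.L ^ k) (y : Site (F.P K) k) (b : PBond (F.P K) 0) :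
    |dgrad (chiB F K k y) b| ≤ 3 / ((F.L : ℝ) ^ k) := by
  obtain ⟨h1, h2, h3⟩ := sizes (F := F) hk
  obtain ⟨m, hm, hm1⟩ := pow_odd (F := F) hn3
  have hc : ∀ i, ctr F K k y i = m := fun i => by rw [ctr_eq hk y i, hm]; omega
  have hcast : ((F.L ^ k : ℕ) : ℝ) = (F.L : ℝ) ^ k := by push_cast; ring
  unfold dgrad chiB
  simp_rw [hc]
  -- split the product at the bond direction
  set μ : Fin 3 := b.dir
  have htgt : b.tgt = b.src.shift μ := rfl
  rw [htgt, ← Finset.mul_prod_erase Finset.univ _ (Finset.mem_univ μ), ← Finset.mul_prod_erase Finset.univ _ (Finset.mem_univ μ)]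
  have hrest : ∏ i ∈ Finset.univ.erase μ, bumpS (F.L ^ k) (N0 F K) m (rho y (b.src.shift μ) i) =
      ∏ i ∈ Finset.univ.erase μ, bumpS (F.L ^ k) (N0 F K) m (rho y b.src i) := by
    refine Finset.prod_congr rfl fun i hi => ?_
    have hiμ : i ≠ μ := Finset.ne_of_mem_erase hi
    simp only [bumpS]
    apply per_congr
    rw [rho_shift_mod, if_neg hiμ, add_zero]
  rw [hrest, ← sub_mul, abs_mul]
  have hP : |∏ i ∈ Finset.univ.erase μ, bumpS (F.L ^ k) (N0 F K) m (rho y b.src i)| ≤ 1 := by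
    rw [abs_of_nonneg (Finset.prod_nonneg fun i _ => (bumpS_facts hm hm1 h1 h2 _).1)]
    exact Finset.prod_le_one (fun i _ => (bumpS_facts hm hm1 h1 h2 _).1) fun i _ => (bumpS_facts hm hm1 h1 h2 _).2.1
  have hstep := (bumpS_facts hm hm1 h1 h2 (rho y b.src μ)).2.2 (rho y (b.src.shift μ) μ) (by rw [rho_shift_mod, if_pos rfl])
  rw [hcast] at hstep
  calc |bumpS (F.L ^ k) (N0 F K) m (rho y (b.src.shift μ) μ) - bumpS (F.L ^ k) (N0 F K) m (rho y b.src μ)| *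
        |∏ i ∈ Finset.univ.erase μ, bumpS (F.L ^ k) (N0 F K) m (rho y b.src i)| ≤ 3 / (F.L : ℝ) ^ k * 1 :=
      mul_le_mul hstep hP (abs_nonneg _) (by positivity)
    _ = 3 / (F.L : ℝ) ^ k := mul_one _

/-- `χ_y` vanishes outside `B^k(y)` and on a site whose offset in some coordinate is `0` (the lower boundary layer). [folklore] -/
theorem chiB_eq_zero_of_coord (hk : k ≤ K) (hn3 : 3 ≤ F.L ^ k) (y : Site (F.P K) k) (z : Site (F.P K) 0) (i : Fin 3)
    (h : ¬ rho y z i % N0 F K < F.L ^ k ∨ rho y z i % N0 F K = 0) : chiB F K k y z = 0 := by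
  obtain ⟨h1, h2, h3⟩ := sizes (F := F) hk
  obtain ⟨m, hm, hm1⟩ := pow_odd (F := F) hn3
  have hc : ctr F K k y i = m := by rw [ctr_eq hk y i, hm]; omega
  unfold chiB
  apply Finset.prod_eq_zero (Finset.mem_univ i)
  rw [hc]
  simp only [bumpS, per]
  rcases h with h | h
  · rw [if_neg h]
  · rw [h, if_pos (by omega)]; exact (bumpV_facts hm hm1 0).2.2.1

/-- **★ SUPPORT: THE KERNEL OF `(y, α)` LIVES ON THE BONDS ISSUING FROM `B^k(y)`** — `obKernel y α b = 0` unless `coarsen k b.src = y` (the product form reads the source; the gauge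
part `dχ_y` needs an endpoint strictly inside the block, and a bond entering the block from outside lands on the boundary layer where `χ_y = 0`). [cite: Balaban1987RG1, (0.3) p.252] -/
theorem obKernel_eq_zero_of_ne (hk : k ≤ K) (hn3 : 3 ≤ F.L ^ k) (y : Site (F.P K) k) (α : Fin 3) (b : PBond (F.P K) 0) (h : coarsen k b.src ≠ y) :
    obKernel F K k y α b = 0 := by
  obtain ⟨h1, h2, h3⟩ := sizes (F := F) hk
  have hsrc : chiB F K k y b.src = 0 := by
    have hne : ¬ ∀ i, (b.src i).val / F.L ^ k = (y i).val := fun hcon => h ((coarsen_eq_iff hk b.src y).mpr hcon)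
    obtain ⟨i, hi⟩ := not_forall.mp hne
    exact chiB_eq_zero_of_coord hk hn3 y b.src i (Or.inl fun hlt => hi ((rho_mod_lt_iff hk y b.src i).mp hlt))
  have htgt : chiB F K k y b.tgt = 0 := by
    by_cases ht : coarsen k b.tgt = y
    · -- the failing coordinate of the source is the bond direction; the target sits on the boundary layer
      have hne : ¬ ∀ i, (b.src i).val / F.L ^ k = (y i).val := fun hcon => h ((coarsen_eq_iff hk b.src y).mpr hcon)
      obtain ⟨i, hi⟩ := not_forall.mp hne
      have hti := ((coarsen_eq_iff hk b.tgt y).mp ht) i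
      have hiμ : i = b.dir := by
        by_contra hne'
        have : (b.tgt i) = (b.src i) := by
          show (b.src.shift b.dir) i = b.src i
          rw [Site.shift_apply, if_neg hne']
        rw [this] at hti; exact hi hti
      subst hiμ
      have hρ : ¬ rho y b.src b.dir % N0 F K < F.L ^ k := fun hlt => hi ((rho_mod_lt_iff hk y b.src b.dir).mp hlt)
      have hρ' : rho y b.tgt b.dir % N0 F K < F.L ^ k := (rho_mod_lt_iff hk y b.tgt b.dir).mpr hti
      have hstep : rho y b.tgt b.dir % N0 F K = (rho y b.src b.dir + 1) % N0 F K := by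
        show rho y (b.src.shift b.dir) b.dir % N0 F K = _
        rw [rho_shift_mod, if_pos rfl]
      refine chiB_eq_zero_of_coord hk hn3 y b.tgt b.dir (Or.inr ?_)
      rcases succ_mod h1 h2 h3 (rho y b.src b.dir) with ⟨e1, e2⟩ | ⟨e1, -⟩
      · rw [hstep, e1] at hρ'; omega
      · rw [hstep, e1]
    · have hne : ¬ ∀ i, (b.tgt i).val / F.L ^ k = (y i).val := fun hcon => ht ((coarsen_eq_iff hk b.tgt y).mpr hcon)
      obtain ⟨i, hi⟩ := not_forall.mp hne
      exact chiB_eq_zero_of_coord hk hn3 y b.tgt i (Or.inl fun hlt => hi ((rho_mod_lt_iff hk y b.tgt i).mp hlt))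
  unfold obKernel
  rw [e0_eq_zero_of_ne hk y α b h, zero_add]
  simp only [dgrad, hsrc, htgt, sub_self, mul_zero]

end Support

/-! ## §3 Sup bounds -/

section Sup

variable {F : T3Family} {K k : ℕ}

/-- **`|e⁰_{(y,α)}(b)| ≤ 64/L^k`** (`|h| ≤ 4/n`, `0 ≤ tent ≤ 4`). [cite: Balaban1985Variational, (8) p.279] -/
theorem abs_e0_le (hk : k ≤ K) (hn3 : 3 ≤ F.L ^ k) (y : Site (F.P K) k) (α : Fin 3) (b : PBond (F.P K) 0) :
    |e0 F K k y α b| ≤ 64 / ((F.L : ℝ) ^ k) := by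
  obtain ⟨h1, h2, h3⟩ := sizes (F := F) hk
  obtain ⟨m, hm, hm1⟩ := pow_odd (F := F) hn3
  have hcast : ((F.L ^ k : ℕ) : ℝ) = (F.L : ℝ) ^ k := by push_cast; ring
  have hLpos : (0 : ℝ) < (F.L : ℝ) ^ k := by rw [← hcast]; exact_mod_cast (show 0 < F.L ^ k by omega)
  unfold e0 form3
  simp only
  split_ifs with hd
  · rw [abs_mul]
    have hh : |hS false (F.L ^ k) (N0 F K) (rho y b.src α)| ≤ 4 / ((F.L : ℝ) ^ k) := by
      rw [← hcast]; exact abs_hS_le h3 false _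
    have hP : |∏ i ∈ Finset.univ.erase α, tS (F.L ^ k) (N0 F K) (rho y b.src i)| ≤ 16 := by
      rw [Finset.abs_prod]
      have hcard : (Finset.univ.erase α).card = 2 := by rw [Finset.card_erase_of_mem (Finset.mem_univ α)]; simp
      calc ∏ i ∈ Finset.univ.erase α, |tS (F.L ^ k) (N0 F K) (rho y b.src i)| ≤ ∏ _i ∈ Finset.univ.erase α, (4 : ℝ) := by
            refine Finset.prod_le_prod (fun i _ => abs_nonneg _) fun i _ => ?_
            rw [abs_of_nonneg (tS_facts hm hm1 h1 h2 _).1]; exact (tS_facts hm hm1 h1 h2 _).2.1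
        _ = 16 := by rw [Finset.prod_const, hcard]; norm_num
    calc |hS false (F.L ^ k) (N0 F K) (rho y b.src α)| * |∏ i ∈ Finset.univ.erase α, tS (F.L ^ k) (N0 F K) (rho y b.src i)| ≤ 4 / (F.L : ℝ) ^ k * 16 :=
        mul_le_mul hh hP (abs_nonneg _) (by positivity)
      _ = 64 / (F.L : ℝ) ^ k := by ring
  · rw [abs_zero]; positivity

/-- **`|Ψ_k(e⁰_{(y,α)})(y′)| ≤ 96`** (★w1's `abs_psiIter_le'`: `≤ (d/2)(L^k − 1)·sup|e⁰|`). [cite: Balaban1987RG1, (0.4)+(0.11) p.253] -/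
theorem abs_psiIter_e0_le (hk : k ≤ K) (hn3 : 3 ≤ F.L ^ k) (y y' : Site (F.P K) k) (α : Fin 3) : |psiIter k (e0 F K k y α) y'| ≤ 96 := by
  have hcast : ((F.L ^ k : ℕ) : ℝ) = (F.L : ℝ) ^ k := by push_cast; ring
  have hLpos : (0 : ℝ) < (F.L : ℝ) ^ k := by
    rw [← hcast]; exact_mod_cast (show 0 < F.L ^ k by omega)
  have h := abs_psiIter_le' (e0 F K k y α) (fun b => abs_e0_le hk hn3 y α b) k y'
  have hd : ((F.P K).d : ℝ) = 3 := by norm_num [show (F.P K).d = 3 from rfl]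
  have hL : ((F.P K).L : ℝ) = F.L := by norm_num [show (F.P K).L = F.L from rfl]
  rw [hd, hL] at h
  refine h.trans ?_
  rw [show (3 : ℝ) / 2 * ((F.L : ℝ) ^ k - 1) * (64 / (F.L : ℝ) ^ k) = 96 * (((F.L : ℝ) ^ k - 1) / (F.L : ℝ) ^ k) by ring]
  have : ((F.L : ℝ) ^ k - 1) / (F.L : ℝ) ^ k ≤ 1 := by rw [div_le_one hLpos]; linarith
  linarith

/-- **★ `|e_{(y,α)}(b)| ≤ 352/L^k`.** [cite: Balaban1985Variational, (8) p.279; Balaban1987RG1, (0.4) p.253] -/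
theorem abs_obKernel_le (hk : k ≤ K) (hn3 : 3 ≤ F.L ^ k) (y : Site (F.P K) k) (α : Fin 3) (b : PBond (F.P K) 0) :
    |obKernel F K k y α b| ≤ 352 / ((F.L : ℝ) ^ k) := by
  have hcast : ((F.L ^ k : ℕ) : ℝ) = (F.L : ℝ) ^ k := by push_cast; ring
  have hLpos : (0 : ℝ) < (F.L : ℝ) ^ k := by rw [← hcast]; exact_mod_cast (show 0 < F.L ^ k by omega)
  unfold obKernel
  calc |e0 F K k y α b + psiIter k (e0 F K k y α) y * dgrad (chiB F K k y) b|
      ≤ |e0 F K k y α b| + |psiIter k (e0 F K k y α) y| * |dgrad (chiB F K k y) b| := by rw [← abs_mul]; exact abs_add_le _ _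
    _ ≤ 64 / (F.L : ℝ) ^ k + 96 * (3 / (F.L : ℝ) ^ k) :=
        add_le_add (abs_e0_le hk hn3 y α b) (mul_le_mul (abs_psiIter_e0_le hk hn3 y y α) (abs_dgrad_chiB_le hk hn3 y b) (abs_nonneg _) (by norm_num))
    _ = 352 / (F.L : ℝ) ^ k := by ring

/-- The one-block lift read at a bond: only the three kernels of the block of its source contribute. [cite: Balaban1987RG1, (0.3) p.252] -/
theorem obLift_apply_eq (hk : k ≤ K) (hn3 : 3 ≤ F.L ^ k) (A : PBond (F.P K) k → ℝ) (b : PBond (F.P K) 0) :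
    obLift F K k A b = ∑ α : Fin 3, A ⟨coarsen k b.src, α⟩ * obKernel F K k (coarsen k b.src) α b := by
  classical
  unfold obLift
  -- re-index the coarse bonds by `(source, direction)`
  let e : Site (F.P K) k × Fin 3 ≃ PBond (F.P K) k := ⟨fun p => ⟨p.1, p.2⟩, fun c => (c.src, c.dir), fun _ => rfl, fun _ => rfl⟩
  rw [← Equiv.sum_comp e, Fintype.sum_prod_type]
  simp only [e, Equiv.coe_fn_mk]
  rw [Finset.sum_eq_single (coarsen k b.src)]
  · intro y _ hy
    exact Finset.sum_eq_zero fun α _ => by rw [obKernel_eq_zero_of_ne hk hn3 y α b (Ne.symm hy), mul_zero]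
  · intro h; exact absurd (Finset.mem_univ _) h

/-- **★★ LOCAL SUP BOUND**: `|obLift A (b)| ≤ (1056/L^k)·max_α |A(coarsen k b₋, α)|` — the bound `M` is asked only of the three coarse bonds issuing from the block of `b₋`.
[cite: Balaban1985Variational, (8) p.279; Balaban1987RG1, (0.11) p.253] -/
theorem abs_obLift_le_local (hk : k ≤ K) (hn3 : 3 ≤ F.L ^ k) (A : PBond (F.P K) k → ℝ) (b : PBond (F.P K) 0) {M : ℝ}
    (hM : ∀ α : Fin 3, |A ⟨coarsen k b.src, α⟩| ≤ M) : |obLift F K k A b| ≤ 1056 / ((F.L : ℝ) ^ k) * M := by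
  have hcast : ((F.L ^ k : ℕ) : ℝ) = (F.L : ℝ) ^ k := by push_cast; ring
  have hLpos : (0 : ℝ) < (F.L : ℝ) ^ k := by rw [← hcast]; exact_mod_cast (show 0 < F.L ^ k by omega)
  have hM0 : 0 ≤ M := (abs_nonneg _).trans (hM 0)
  rw [obLift_apply_eq hk hn3]
  calc |∑ α : Fin 3, A ⟨coarsen k b.src, α⟩ * obKernel F K k (coarsen k b.src) α b|
      ≤ ∑ α : Fin 3, |A ⟨coarsen k b.src, α⟩ * obKernel F K k (coarsen k b.src) α b| := Finset.abs_sum_le_sum_abs _ _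
    _ ≤ ∑ _α : Fin 3, M * (352 / (F.L : ℝ) ^ k) := Finset.sum_le_sum fun α _ => by
        rw [abs_mul]; exact mul_le_mul (hM α) (abs_obKernel_le hk hn3 _ α b) (abs_nonneg _) hM0
    _ = 1056 / (F.L : ℝ) ^ k * M := by simp only [Finset.sum_const, Finset.card_univ, Fintype.card_fin, nsmul_eq_mul]; ring

/-- **GLOBAL SUP BOUND**: `|A| ≤ M ⇒ |obLift A (b)| ≤ (1056/L^k)·M`. [cite: Balaban1987RG1, (0.11) p.253] -/
theorem abs_obLift_le (hk : k ≤ K) (hn3 : 3 ≤ F.L ^ k) (A : PBond (F.P K) k → ℝ) {M : ℝ} (hM : ∀ c, |A c| ≤ M) (b : PBond (F.P K) 0) :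
    |obLift F K k A b| ≤ 1056 / ((F.L : ℝ) ^ k) * M :=
  abs_obLift_le_local hk hn3 A b fun _ => hM _

/-- **LOCALITY**: `obLift A (b)` reads `A` only at the three coarse bonds issuing from the block of `b₋`. [cite: Balaban1987RG1, (0.3) p.252] -/
theorem obLift_congr_local (hk : k ≤ K) (hn3 : 3 ≤ F.L ^ k) (A A' : PBond (F.P K) k → ℝ) (b : PBond (F.P K) 0)
    (h : ∀ α : Fin 3, A ⟨coarsen k b.src, α⟩ = A' ⟨coarsen k b.src, α⟩) : obLift F K k A b = obLift F K k A' b := by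
  rw [obLift_apply_eq hk hn3, obLift_apply_eq hk hn3]
  exact Finset.sum_congr rfl fun α _ => by rw [h α]

/-- `obLift A (b) = 0` when `A` vanishes on the three coarse bonds issuing from the block of `b₋`. [cite: Balaban1987RG1, (0.3) p.252] -/
theorem obLift_eq_zero_of_local (hk : k ≤ K) (hn3 : 3 ≤ F.L ^ k) (A : PBond (F.P K) k → ℝ) (b : PBond (F.P K) 0)
    (h : ∀ α : Fin 3, A ⟨coarsen k b.src, α⟩ = 0) : obLift F K k A b = 0 := by
  rw [obLift_apply_eq hk hn3]
  exact Finset.sum_eq_zero fun α _ => by rw [h α, zero_mul]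

end Sup

end Summit.QuantumFields.YangMills.Theorems.AbelianEML.OneBlock

end
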